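import Summits.QuantumFields.YangMills.Theorems.BalabanLadderIRcofEquipartitionSeamSliceKernelBlockChain
import HarnessLib

/-!
# Crux `IRcof` (stmt-QuantumFields-26930) · line `equipartition_seam` (row 47) · located stub **L `SpectralDict.SliceRealisationV`** —
# PART 4 ∕ 4 — the cyclic relabelling of the time axis (`relabel`, `rotAmt`), the time window of a species (`tLo` ∕ `tHi` ∕ `thick` ∕ `nrm`, `speciesL5`, `window_relabel`), `secW_withEl_eq_blockChain_of`, and ★★★ `sliceRealisationV_holds : SpectralDict.SliceRealisationV` — the LOCATED STUB L of row 47, sorry-free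

SOURCE OF RECORD: `Cruxes/IRcof/Lines/equipartition_seam_SliceRealisation.lean` rev 1 (crux write 0079346b2e66, 1445 l., 77 decls; author ideator ym-ir-idea-22 g8; LAND-ASK «stub L» bus l.≈1828; critic ym-ir-crit-3 g6 TYPEREAD asked there) — cut VERBATIM at its `PART k` banners into ≤ 400-line Theorems files by LEAD prover ym-ir-line-ab-p1 g8, each importing the previous; the author's `set_option maxHeartbeats 400000 in` lines (six, pre-budgeted per ops-buildfix-2) are kept verbatim.

HONEST FRAMING.  Finite-box Fubini ∕ Haar bookkeeping (the transfer-operator REALISATION of the split-weight sector functions); it closes the LOCATED typing stub L `SpectralDict.SliceRealisationV` of row 47 only in PART 4 and proves NO constructive-QFT estimate: the located stubs S1 · S3ʷ · T · N · S5ᵛ stay open; row 47 class PWP, mechanism 0, width 0; `IRcof` ∕ `IR` 0∕1; the Yang–Mills mass gap (Clay) is NOT proved by anything in this tree; R4 closes only the conditional finite-𝕋⁴ rung `BalabanLadder.UV`.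
-/

noncomputable section

open MeasureTheory ProbabilityTheory Finset Filter Function
open scoped BigOperators

namespace Summit.QuantumFields.YangMills.Cruxes.IRcof.EquipartitionSeam.SliceKernel

open Literature.MathematicalPhysics.QuantumFieldTheory (haarProbability)
open Literature.Analysis.OperatorTheory (measurePreserving_finSplit finSplit_apply_fst finSplit_apply_snd
  integral_pi_comp_perm)
open Summit.QuantumFields.YangMills.Cruxes.IRcof.EquipartitionSeam.SpectralDict (pathK)

/-! ## PART 4 — the relabelling, the window of a species, and the located stub L -/

/-! ### The cyclic relabelling of the time axis -/

section Relabel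

/-- **The cyclic relabelling** `t ↦ cast t + c` of a time axis of length `m' = m` by a rotation `c`. -/
def relabel {m' m : ℕ} [NeZero m] (h : m' = m) (c : Fin m) : Fin m' ≃ Fin m :=
  (finCongr h).trans (Equiv.addRight c)

/-- `((finRotate m t) : ℕ) = (t + 1) % m` — private copy (the public twin is `Literature.Probability.RandomPlanarGeometry.val_finRotate_eq_mod`; PART 1's copy is `private` for the same dedup reason). -/
private theorem val_finRotate {m : ℕ} (t : Fin m) : ((finRotate m t : Fin m) : ℕ) = ((t : ℕ) + 1) % m := by
  cases m with
  | zero => exact t.elim0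
  | succ n =>
    rw [finRotate_apply, Fin.val_add, Fin.val_one', Nat.add_mod_mod]

/-- Auxiliary `val_relabel` of the slice-realisation port (its statement is its type; rôle explained in the module ∕ section docstrings). -/
theorem val_relabel {m' m : ℕ} [NeZero m] (h : m' = m) (c : Fin m) (t : Fin m') :
    ((relabel h c t : Fin m) : ℕ) = ((t : ℕ) + c) % m := by
  subst h; rfl

/-- The relabelling commutes with the cyclic shifts. -/
theorem relabel_finRotate {m' m : ℕ} [NeZero m] (h : m' = m) (c : Fin m) (t : Fin m') :
    relabel h c (finRotate m' t) = finRotate m (relabel h c t) := by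
  subst h
  apply Fin.ext
  rw [val_relabel, val_finRotate, val_finRotate, val_relabel, Nat.mod_add_mod, Nat.mod_add_mod,
    Nat.add_right_comm]

/-- **Relabelling the time axis of a joint slice∕layer integral** along any `σ : Fin m' ≃ Fin m`
(`measurePreserving_piCongrLeft` on both factors). -/
theorem integral_comp_relabel {Y Z : Type*} [MeasurableSpace Y] [MeasurableSpace Z] (μ : Measure Y) (ν : Measure Z)
    [SigmaFinite μ] [SigmaFinite ν] {m m' : ℕ} (σ : Fin m' ≃ Fin m) (Φ : (Fin m → Y) × (Fin m → Z) → ℝ) :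
    ∫ q : (Fin m' → Y) × (Fin m' → Z), Φ (fun t => q.1 (σ.symm t), fun t => q.2 (σ.symm t))
        ∂((Measure.pi fun _ : Fin m' => μ).prod (Measure.pi fun _ : Fin m' => ν)) =
      ∫ q, Φ q ∂((Measure.pi fun _ : Fin m => μ).prod (Measure.pi fun _ : Fin m => ν)) := by
  have h1 : MeasurePreserving (MeasurableEquiv.piCongrLeft (fun _ : Fin m' => Y) σ.symm).symm
      (Measure.pi fun _ : Fin m' => μ) (Measure.pi fun _ : Fin m => μ) :=
    (measurePreserving_piCongrLeft (fun _ : Fin m' => μ) σ.symm).symm _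
  have h2 : MeasurePreserving (MeasurableEquiv.piCongrLeft (fun _ : Fin m' => Z) σ.symm).symm
      (Measure.pi fun _ : Fin m' => ν) (Measure.pi fun _ : Fin m => ν) :=
    (measurePreserving_piCongrLeft (fun _ : Fin m' => ν) σ.symm).symm _
  exact (h1.prod h2).integral_comp
    ((MeasurableEquiv.piCongrLeft (fun _ : Fin m' => Y) σ.symm).symm.measurableEmbedding.prodMap
      (MeasurableEquiv.piCongrLeft (fun _ : Fin m' => Z) σ.symm).symm.measurableEmbedding) Φ

/-- Products over a relabelled time axis. -/
theorem prod_comp_relabel {m m' : ℕ} (σ : Fin m' ≃ Fin m) (f : Fin m → ℝ) : ∏ t', f (σ t') = ∏ t, f t :=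
  Fintype.prod_equiv σ _ _ fun _ => rfl

/-- `ZMod.finEquiv` preserves the residue. -/
private theorem val_finEquiv_symm (L : ℕ) [NeZero L] (x : ZMod L) : (((ZMod.finEquiv L).symm x : Fin L) : ℕ) = x.val := by
  cases L with
  | zero => exact (NeZero.ne 0 rfl).elim
  | succ n => rfl

/-- The rotation amount putting the block of the layout `Fin ((M + 3) + (r + 2))` onto the time window starting at
`t₀ (mod L)`: `c ≡ t₀ − (M + 3) (mod L)`. -/
def rotAmt (L : ℕ) [NeZero L] (t₀ : ℤ) (M : ℕ) : Fin L :=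
  ⟨((t₀ - ((M : ℤ) + 3)) % (L : ℤ)).toNat, by
    have hL : (0 : ℤ) < L := by exact_mod_cast Nat.pos_of_ne_zero (NeZero.ne L)
    have h0 := Int.emod_nonneg (t₀ - ((M : ℤ) + 3)) hL.ne'
    have h1 := Int.emod_lt_of_pos (t₀ - ((M : ℤ) + 3)) hL
    generalize (t₀ - ((M : ℤ) + 3)) % (L : ℤ) = y at h0 h1
    omega⟩

/-- **The block hits the window**: with `c = rotAmt L t₀ M`, the block slice `natAdd (M+3) b` of the layout is relabelled to
the time `t₀ + b (mod L)`, i.e. to the `zCoord`-time of any edge whose first coordinate is `t₀ + b`. -/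
theorem relabel_natAdd_eq {L M r : ℕ} [NeZero L] (h : (M + 3) + (r + 2) = L) (t₀ : ℤ) (b : Fin (r + 2)) (x : ℤ)
    (hx : x = t₀ + b) :
    relabel h (rotAmt L t₀ M) (Fin.natAdd (M + 3) b) = (ZMod.finEquiv L).symm ((x : ℤ) : ZMod L) := by
  apply Fin.ext
  rw [val_finEquiv_symm, val_relabel, Fin.val_natAdd]
  have hL0 : (L : ℤ) ≠ 0 := by exact_mod_cast NeZero.ne L
  have e2 : ((((t₀ - ((M : ℤ) + 3)) % (L : ℤ)).toNat : ℕ) : ℤ) = (t₀ - ((M : ℤ) + 3)) % (L : ℤ) :=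
    Int.toNat_of_nonneg (Int.emod_nonneg _ hL0)
  refine Int.natCast_inj.mp ?_
  rw [ZMod.val_intCast, hx]
  push_cast
  rw [rotAmt, Fin.val_mk, e2]
  have hme : ((M : ℤ) + 3 + (b : ℕ) + (t₀ - ((M : ℤ) + 3)) % (L : ℤ)) ≡
      ((M : ℤ) + 3 + (b : ℕ) + (t₀ - ((M : ℤ) + 3))) [ZMOD (L : ℤ)] :=
    (Int.mod_modEq _ _).add_left _
  rw [Int.ModEq] at hme
  rw [hme]
  congr 1
  ring

end Relabel

/-! ### The temporal window of a species and its size -/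

section SpeciesData

open Literature.MathematicalPhysics.QuantumFieldTheory Literature.MathematicalPhysics.QuantumLattice

variable {G : Type} [Group G] [MeasurableSpace G]

/-- The time coordinates (first `ℤ⁴`-coordinate of the base point) of the support edges of a species. -/
def times (A : YMSpecies G) : Finset ℤ := A.supp.image fun d => d.1 0

/-- First time of the support window of a species (`0` for an empty support). -/
def tLo (A : YMSpecies G) : ℤ := if h : (times A).Nonempty then (times A).min' h else 0

/-- Last time of the support window of a species (`0` for an empty support). -/
def tHi (A : YMSpecies G) : ℤ := if h : (times A).Nonempty then (times A).max' h else 0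

/-- Auxiliary `tLo_le` of the slice-realisation port (its statement is its type; rôle explained in the module ∕ section docstrings). -/
theorem tLo_le (A : YMSpecies G) {d : Literature.MathematicalPhysics.QuantumLattice.ZdEdge 4} (hd : d ∈ A.supp) : tLo A ≤ d.1 0 := by
  have hm : d.1 0 ∈ times A := Finset.mem_image.mpr ⟨d, hd, rfl⟩
  rw [tLo, dif_pos ⟨_, hm⟩]
  exact Finset.min'_le _ _ hm

/-- Auxiliary `le_tHi` of the slice-realisation port (its statement is its type; rôle explained in the module ∕ section docstrings). -/
theorem le_tHi (A : YMSpecies G) {d : Literature.MathematicalPhysics.QuantumLattice.ZdEdge 4} (hd : d ∈ A.supp) : d.1 0 ≤ tHi A := by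
  have hm : d.1 0 ∈ times A := Finset.mem_image.mpr ⟨d, hd, rfl⟩
  rw [tHi, dif_pos ⟨_, hm⟩]
  exact Finset.le_max' _ _ hm

/-- Auxiliary `tLo_le_tHi` of the slice-realisation port (its statement is its type; rôle explained in the module ∕ section docstrings). -/
theorem tLo_le_tHi (A : YMSpecies G) : tLo A ≤ tHi A := by
  unfold tLo tHi
  split_ifs with h
  · exact Finset.min'_le _ _ (Finset.max'_mem _ h)
  · exact le_rfl

/-- **Temporal THICKNESS** of a species: the number of consecutive time slices spanned by its support window (`≥ 1`). -/
def thick (A : YMSpecies G) : ℕ := (tHi A - tLo A).toNat + 1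

/-- Auxiliary `one_le_thick` of the slice-realisation port (its statement is its type; rôle explained in the module ∕ section docstrings). -/
theorem one_le_thick (A : YMSpecies G) : 1 ≤ thick A := Nat.le_add_left 1 _

/-- **SIZE** of a species: a nonnegative uniform bound of `A.F`. -/
def nrm (A : YMSpecies G) : ℝ := max (Classical.choose A.bounded) 0

/-- Auxiliary `abs_le_nrm` of the slice-realisation port (its statement is its type; rôle explained in the module ∕ section docstrings). -/
theorem abs_le_nrm (A : YMSpecies G) (U : LGConfig 4 G) : |A.F U| ≤ nrm A :=
  (Classical.choose_spec A.bounded U).trans (le_max_left _ _)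

/-- Auxiliary `nrm_nonneg` of the slice-realisation port (its statement is its type; rôle explained in the module ∕ section docstrings). -/
theorem nrm_nonneg (A : YMSpecies G) : 0 ≤ nrm A := le_max_right _ _

end SpeciesData

/-! ### The species in the block layout -/

section Layout

open Literature.MathematicalPhysics.QuantumFieldTheory Literature.MathematicalPhysics.QuantumLattice
open Literature.MathematicalPhysics.QuantumLattice (torusLift torusEdge)

variable {G H : Type} [Group G] [MeasurableSpace G] [Group H] [MeasurableSpace H] (π : H →* G)

/-- **The pulled-back species in the block layout**: `Ã(assembleZero ·)` read through a relabelling `σ` of the time axis. -/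
def speciesL5 {L m' : ℕ} [NeZero L] (A : YMSpecies G) (σ : Fin m' ≃ Fin L)
    (q : (Fin m' → (FinSpatialSite L L L × Fin 3 → H)) × (Fin m' → (FinSpatialSite L L L → H))) : ℝ :=
  A.F (fun d => π (torusLift L ((finTorusConfigEquivSite H L).symm
    (assembleZero ((fun t => q.1 (σ.symm t), fun t => q.2 (σ.symm t)) :
      (Fin L → (FinSpatialSite L L L × Fin 3 → H)) × (Fin L → (FinSpatialSite L L L → H))))) d))

/-- Auxiliary `abs_speciesL5_le` of the slice-realisation port (its statement is its type; rôle explained in the module ∕ section docstrings). -/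
theorem abs_speciesL5_le {L m' : ℕ} [NeZero L] (A : YMSpecies G) (σ : Fin m' ≃ Fin L)
    (q : (Fin m' → (FinSpatialSite L L L × Fin 3 → H)) × (Fin m' → (FinSpatialSite L L L → H))) :
    |speciesL5 π A σ q| ≤ nrm A :=
  abs_le_nrm A _

/-- Auxiliary `measurable_speciesL5` of the slice-realisation port (its statement is its type; rôle explained in the module ∕ section docstrings). -/
theorem measurable_speciesL5 [TopologicalSpace G] [BorelSpace G] [TopologicalSpace H] [BorelSpace H]
    (hπ : Continuous π) {L m' : ℕ} [NeZero L] (A : YMSpecies G) (σ : Fin m' ≃ Fin L) :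
    Measurable (speciesL5 π A σ :
      (Fin m' → (FinSpatialSite L L L × Fin 3 → H)) × (Fin m' → (FinSpatialSite L L L → H)) → ℝ) := by
  have hre : Measurable fun q : (Fin m' → (FinSpatialSite L L L × Fin 3 → H)) × (Fin m' → (FinSpatialSite L L L → H)) =>
      ((fun t => q.1 (σ.symm t), fun t => q.2 (σ.symm t)) :
        (Fin L → (FinSpatialSite L L L × Fin 3 → H)) × (Fin L → (FinSpatialSite L L L → H))) :=
    (measurable_pi_lambda _ fun t => (measurable_pi_apply (σ.symm t)).comp measurable_fst).prodMk
      (measurable_pi_lambda _ fun t => (measurable_pi_apply (σ.symm t)).comp measurable_snd)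
  refine A.measurable.comp (measurable_pi_lambda _ fun d => hπ.measurable.comp ?_)
  exact (measurable_pi_apply _).comp ((finTorusConfigEquivSite H L).symm.measurable.comp
    (measurable_assembleZero.comp hre))

/-- **Window**: if every support edge of `A` has its `zCoord`-time among the relabelled block layers
`σ (natAdd (M+3) b.castSucc)`, the species in the block layout reads only the block slices and block layers. -/
theorem speciesL5_dep {L M r : ℕ} [NeZero L] (A : YMSpecies G) (σ : Fin ((M + 3) + (r + 2)) ≃ Fin L)
    (hwin : ∀ d ∈ A.supp, ∃ b : Fin (r + 1), (zCoord L d).1 = σ (Fin.natAdd (M + 3) (Fin.castSucc b)))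
    (q q' : (Fin ((M + 3) + (r + 2)) → (FinSpatialSite L L L × Fin 3 → H)) ×
      (Fin ((M + 3) + (r + 2)) → (FinSpatialSite L L L → H)))
    (h1 : ∀ i, q.1 (Fin.natAdd (M + 3) i) = q'.1 (Fin.natAdd (M + 3) i))
    (h2 : ∀ b : Fin (r + 1), q.2 (Fin.natAdd (M + 3) (Fin.castSucc b)) = q'.2 (Fin.natAdd (M + 3) (Fin.castSucc b))) :
    speciesL5 π A σ q = speciesL5 π A σ q' := by
  unfold speciesL5
  refine pullback_assembleZero_congr π A fun d hd => ?_
  obtain ⟨b, hb⟩ := hwin d hd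
  dsimp only
  rw [hb, Equiv.symm_apply_apply]
  exact ⟨h1 (Fin.castSucc b), h2 b⟩

/-- The window hypothesis for the relabelling `relabel h (rotAmt L (tLo A) M)` of a species of thickness `r + 1`. -/
theorem window_relabel {L M r : ℕ} [NeZero L] (A : YMSpecies G) (h : (M + 3) + (r + 2) = L) (hr : r + 1 = thick A)
    {d : Literature.MathematicalPhysics.QuantumLattice.ZdEdge 4} (hd : d ∈ A.supp) :
    ∃ b : Fin (r + 1), (zCoord L d).1 = relabel h (rotAmt L (tLo A) M) (Fin.natAdd (M + 3) (Fin.castSucc b)) := by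
  have h1 := tLo_le A hd
  have h2 := le_tHi A hd
  have hb : (d.1 0 - tLo A).toNat < r + 1 := by unfold thick at hr; omega
  refine ⟨⟨(d.1 0 - tLo A).toNat, hb⟩, ?_⟩
  have hz : (zCoord L d).1 = (ZMod.finEquiv L).symm ((d.1 0 : ℤ) : ZMod L) := by rw [zCoord_eq]
  rw [hz]
  refine (relabel_natAdd_eq h (tLo A) (Fin.castSucc ⟨(d.1 0 - tLo A).toNat, hb⟩) (d.1 0) ?_).symm
  rw [Fin.val_castSucc, Fin.val_mk, Int.toNat_of_nonneg (by omega)]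
  ring

end Layout

/-! ### The windowed section in block-chain form and the located stub L -/

section SecWBlock

open Literature.MathematicalPhysics.QuantumFieldTheory Literature.MathematicalPhysics.QuantumLattice
open Literature.MathematicalPhysics.QuantumLattice (torusLift torusEdge)
open Summit.QuantumFields.YangMills.Cruxes.IRcof.EquipartitionSeam.KernelCurrency (sectorTensor withEl secZ secW)

variable {G H : Type} [Group G] [TopologicalSpace G] [MeasurableSpace G] [BorelSpace G] [Group H] [TopologicalSpace H]
  [IsTopologicalGroup H] [CompactSpace H] [MeasurableSpace H] [BorelSpace H] [SecondCountableTopology H] (π : H →* G)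

set_option maxHeartbeats 400000 in
/-- **`W_{w,A}(withEl z₀ e)` AS A BLOCK CHAIN** — step (a) `secW_withEl_eq_integral_layers_seamAt` (seam parked on the layer
after the block) + the relabelling of the time axis along `σ` + the abstract steps (b)–(d) `integral_layers_eq_blockChain`. -/
theorem secW_withEl_eq_blockChain_of (w : H → ℝ) (hw : Continuous w) (hw0 : ∀ h, 0 ≤ w h) {Cw : ℝ} (hwC : ∀ h, w h ≤ Cw)
    (hcl : ∀ g h : H, w (g * h * g⁻¹) = w h) (hker : π.ker ≤ Subgroup.center H) (hπ : Continuous π) (z₀ : Sector π)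
    (S : ℕ) (A : YMSpecies G) (M r : ℕ) (σ : Fin ((M + 3) + (r + 2)) ≃ Fin (2 * S + 1))
    (hσ : ∀ t, σ (finRotate _ t) = finRotate _ (σ t))
    (hwin : ∀ d ∈ A.supp, ∃ b : Fin (r + 1), (zCoord (2 * S + 1) d).1 = σ (Fin.natAdd (M + 3) (Fin.castSucc b)))
    (e : Fin 3 → ↥π.ker) :
    secW π w (withEl π z₀ e) S A =
      ∫ V : Fin (M + 3) → (FinSpatialSite (2 * S + 1) (2 * S + 1) (2 * S + 1) × Fin 3 → H),
        (∫ u, sandKernel Prod.fst (fun l : FinSpatialSite (2 * S + 1) (2 * S + 1) (2 * S + 1) × Fin 3 => l.1.shift l.2) w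
              (fun V => Real.sqrt (magW π w z₀ V)) (V 0) u *
            ∫ v, blockKernel Prod.fst (fun l : FinSpatialSite (2 * S + 1) (2 * S + 1) (2 * S + 1) × Fin 3 => l.1.shift l.2)
                w (fun V => Real.sqrt (magW π w z₀ V)) M r (speciesL5 π A σ) u v *
              sandKernel Prod.fst (fun l : FinSpatialSite (2 * S + 1) (2 * S + 1) (2 * S + 1) × Fin 3 => l.1.shift l.2) w
                (fun V => Real.sqrt (magW π w z₀ V)) (ctwist (elTwist π e⁻¹) v) (V 1)
            ∂(Measure.pi fun _ : FinSpatialSite (2 * S + 1) (2 * S + 1) (2 * S + 1) × Fin 3 => haarProbability H)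
            ∂(Measure.pi fun _ : FinSpatialSite (2 * S + 1) (2 * S + 1) (2 * S + 1) × Fin 3 => haarProbability H)) *
          ∏ t : Fin (M + 2), sandKernel Prod.fst
            (fun l : FinSpatialSite (2 * S + 1) (2 * S + 1) (2 * S + 1) × Fin 3 => l.1.shift l.2) w
            (fun V => Real.sqrt (magW π w z₀ V)) (V t.succ) (V (t.succ + 1))
        ∂(Measure.pi fun _ => Measure.pi fun _ : FinSpatialSite (2 * S + 1) (2 * S + 1) (2 * S + 1) × Fin 3 =>
          haarProbability H) := by
  have hσ' : ∀ t, σ.symm (finRotate _ (σ t)) = finRotate _ t := fun t => by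
    rw [Equiv.symm_apply_eq, hσ]
  have haT : ∀ V : FinSpatialSite (2 * S + 1) (2 * S + 1) (2 * S + 1) × Fin 3 → H,
      (fun V => Real.sqrt (magW π w z₀ V)) (ctwist (elTwist π e)⁻¹ V) = (fun V => Real.sqrt (magW π w z₀ V)) V := by
    intro V
    dsimp only
    rw [← elTwist_inv]
    exact sqrt_magW_ctwist_elTwist π w hker z₀ e⁻¹ V
  have hsm₁ : (fun t => seamAt (σ (Fin.natAdd (M + 3) (Fin.last (r + 1)))) (elTwist π e) (σ t))
      (Fin.natAdd (M + 3) (Fin.last (r + 1))) =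
      (elTwist π e : FinSpatialSite (2 * S + 1) (2 * S + 1) (2 * S + 1) × Fin 3 → H) :=
    seamAt_self _ _
  have hsm₀ : ∀ t, t ≠ Fin.natAdd (M + 3) (Fin.last (r + 1)) →
      (fun t => seamAt (σ (Fin.natAdd (M + 3) (Fin.last (r + 1)))) (elTwist π e) (σ t)) t =
        (1 : FinSpatialSite (2 * S + 1) (2 * S + 1) (2 * S + 1) × Fin 3 → H) :=
    fun t ht => seamAt_of_ne _ fun h' => ht (σ.injective h')
  rw [secW_withEl_eq_integral_layers_seamAt π w hw hcl hker hπ z₀ e S A (σ (Fin.natAdd (M + 3) (Fin.last (r + 1)))),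
    elTwist_inv]
  refine Eq.trans ?_ (integral_layers_eq_blockChain Prod.fst
    (fun l : FinSpatialSite (2 * S + 1) (2 * S + 1) (2 * S + 1) × Fin 3 => l.1.shift l.2) w
    (fun V => Real.sqrt (magW π w z₀ V)) hw hw0 hwC (measurable_sqrt_magW π w hw z₀)
    (abs_sqrt_magW_le π w hw0 hwC z₀) (Mg := magW π w z₀) (fun V => (sq_sqrt_magW π w hw0 z₀ V).symm)
    (elTwist_mem_center π hker e) haT M r (measurable_speciesL5 π hπ A σ) (abs_speciesL5_le π A σ)
    (speciesL5_dep π A σ hwin) hsm₁ hsm₀)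
  refine ((integral_comp_relabel
    (Measure.pi fun _ : FinSpatialSite (2 * S + 1) (2 * S + 1) (2 * S + 1) × Fin 3 => haarProbability H)
    (Measure.pi fun _ : FinSpatialSite (2 * S + 1) (2 * S + 1) (2 * S + 1) => haarProbability H) σ _).symm).trans ?_
  refine integral_congr_ae (Eventually.of_forall fun q => ?_)
  dsimp only
  unfold speciesL5
  congr 1
  rw [← prod_comp_relabel σ (fun t => magW π w z₀ (q.1 (σ.symm t))),
    ← prod_comp_relabel σ (fun t => tempKernel Prod.fst
      (fun l : FinSpatialSite (2 * S + 1) (2 * S + 1) (2 * S + 1) × Fin 3 => l.1.shift l.2) w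
      (q.1 (σ.symm t)) (q.2 (σ.symm t))
      (ctwist (seamAt (σ (Fin.natAdd (M + 3) (Fin.last (r + 1)))) (elTwist π e) t) (q.1 (σ.symm (finRotate _ t)))))]
  simp only [Equiv.symm_apply_apply, hσ']

/-- **THE LOCATED STUB L — time-slice realisation of the split-weight sector functions — PROVED.**
Witnesses: `thick` ∕ `nrm` = temporal thickness ∕ size of a species, `β_D := 0`, `S_D := 0`; for each `z₀`:
`X :=` the spatial links of one time slice of the box `(2S+1)⁴`, `μ := ⊗Haar`, `K :=` the gauge-averaged slice kernel
sandwiched by `√magW` (`sandKernel`), `T e := ctwist (elTwist π e⁻¹)`; the (Z) side is `zPackage_of_twistSplitWeight` (+ the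
real → complex positive-type bridge `SpectralDict.complexPosType_of_real`), the (W) side is `blockKernel` of the species in the
block layout, `norm_blockKernel_le`, `abs_blockKernel_le_pathK` and `secW_withEl_eq_blockChain_of` along `relabel`. -/
theorem sliceRealisationV_holds : SpectralDict.SliceRealisationV := by
  intro G _ _ _ _ _ _ _ H _ _ _ _ _ _ _ _ π hπ _ hker _ _ ρH r c _
  haveI : SecondCountableTopology H :=
    (ρH.continuous.isClosedEmbedding ρH.injective).isEmbedding.secondCountableTopology
  refine ⟨thick, nrm, 0, fun _ => 0, fun A => ⟨one_le_thick A, nrm_nonneg A⟩, ?_⟩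
  intro β _ w hT S _ z₀
  have hw : Continuous w := hT.1
  have hw0 : ∀ h, 0 ≤ w h := hT.2.1
  have hcl : ∀ g h : H, w (g * h * g⁻¹) = w h := hT.2.2.2.1
  obtain ⟨h₀, -, hmax⟩ := isCompact_univ.exists_isMaxOn Set.univ_nonempty hw.continuousOn
  have hwC : ∀ h, w h ≤ w h₀ := fun h => hmax (Set.mem_univ h)
  obtain ⟨C, hP, hCG, hSM, hbd, hsym, hpos, hTμ, hT1, hTmul, hKT, hZ⟩ := zPackage_of_twistSplitWeight π hT hker z₀ S
  refine ⟨(FinSpatialSite (2 * S + 1) (2 * S + 1) (2 * S + 1) × Fin 3 → H), inferInstance,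
    Measure.pi fun _ : FinSpatialSite (2 * S + 1) (2 * S + 1) (2 * S + 1) × Fin 3 => haarProbability H,
    sandKernel Prod.fst (fun l : FinSpatialSite (2 * S + 1) (2 * S + 1) (2 * S + 1) × Fin 3 => l.1.shift l.2) w
      (fun V => Real.sqrt (magW π w z₀ V)),
    C, fun e => ctwist (elTwist π e⁻¹), hP, hCG, hSM, hbd, hsym,
    fun f hf hf1 => SpectralDict.complexPosType_of_real hSM hbd hpos f hf hf1, hTμ, hT1, hTmul, hKT, hZ, ?_⟩
  intro A hA
  obtain ⟨r, hr⟩ : ∃ r : ℕ, r + 1 = thick A := ⟨thick A - 1, by have := one_le_thick A; omega⟩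
  obtain ⟨M₀, h₀⟩ : ∃ M₀ : ℕ, (M₀ + 3) + (r + 2) = 2 * S + 1 := ⟨2 * S + 1 - (r + 5), by omega⟩
  have ha : Measurable fun V : FinSpatialSite (2 * S + 1) (2 * S + 1) (2 * S + 1) × Fin 3 → H =>
      Real.sqrt (magW π w z₀ V) := measurable_sqrt_magW π w hw z₀
  have haC := abs_sqrt_magW_le π w hw0 hwC z₀
    (b₁ := 2 * S + 1) (b₂ := 2 * S + 1) (b₃ := 2 * S + 1)
  have hFm := measurable_speciesL5 π hπ A (relabel h₀ (rotAmt (2 * S + 1) (tLo A) M₀))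
  have hFb := abs_speciesL5_le π A (relabel h₀ (rotAmt (2 * S + 1) (tLo A) M₀)) (H := H)
  refine ⟨r, blockKernel Prod.fst (fun l : FinSpatialSite (2 * S + 1) (2 * S + 1) (2 * S + 1) × Fin 3 => l.1.shift l.2)
      w (fun V => Real.sqrt (magW π w z₀ V)) M₀ r (speciesL5 π A (relabel h₀ (rotAmt (2 * S + 1) (tLo A) M₀))),
    _, hr, stronglyMeasurable_uncurry_blockKernel _ _ w _ hw ha M₀ r hFm,
    norm_blockKernel_le _ _ w _ hw0 hwC haC M₀ r hFb,
    fun u v => abs_blockKernel_le_pathK _ _ w _ hw hw0 hwC ha haC (fun V => Real.sqrt_nonneg _) M₀ r hFm hFb u v,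
    fun e M hM => ?_⟩
  obtain rfl : M = M₀ := by omega
  exact secW_withEl_eq_blockChain_of π w hw hw0 hwC hcl hker hπ z₀ S A M r _
    (relabel_finRotate h₀ (rotAmt (2 * S + 1) (tLo A) M)) (fun d hd => window_relabel A h₀ hr hd) e

end SecWBlock

end Summit.QuantumFields.YangMills.Cruxes.IRcof.EquipartitionSeam.SliceKernel

end
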